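import Summits.Ventures.HodgeRepro2.T5SU11ImproperHardyClass
import Summits.Ventures.HodgeRepro2.T5SU11ResolventNeumann

/-!
# The sharp `L²` bound of the iterates of the resolvent on the class

For `λ > 1` and a source `g` of the exponentially decaying class at a rate `ε > 1`, the iterates `(G^I_λ)ⁿ g` stay in the
class (row 503, at every rate `ε′ < min(ε, λ)`, in particular at a rate `> 1`), so row 532's sharp bound
`‖G^I_λ h‖² ≤ ‖h‖²/(λ − 1)⁴` applies at every step:

**`‖(G^I_λ)ⁿ g‖² ≤ ‖g‖²/((λ − 1)⁴)ⁿ`** (`integral_sinh_mul_iterate_sq_le`) in `L²((0, ∞), sinh 2t dt)`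

— the `L²` operator norm of the resolvent on the class is at most `1/(λ − 1)²` and so is, iterated, that of its powers;
hence the terms of the Neumann series of row 506 are geometric in `L²` with ratio `|μ′ − μ|/(λ − 1)²`
(`neumann_term_l2_le`). Nothing is claimed about (N).

Blind lane: Mathlib + the HodgeRepro2 prefix only; no sorry; axioms ⊆ {propext, Classical.choice,
Quot.sound}.
-/

namespace Summit.Ventures.HodgeRepro2.T5SU11ImproperL2Iterates

open Filter Topology MeasureTheory
open Set (Ioi Ioc)
open T5SU11Cartan T5SU11SphericalFunction T5SU11SphericalDecay T5SU11RadialGreenImproper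
  T5SU11RadialGreenImproperStable T5SU11ResolventNeumann T5SU11ImproperHardyClass

section measure

variable [MeasurableSpace Circle] [BorelSpace Circle]

variable {lam : ℝ} (hlam : 1 < lam) {g : ℝ → ℝ} (hg : ContinuousOn g (Ioi 0))
  {M : ℝ} (hM : ∀ s ∈ Ioc (0 : ℝ) 1, |g s| ≤ M) (hM0 : 0 ≤ M)
  {ε C s₀ : ℝ} (hC : ∀ s, s₀ ≤ s → |g s| ≤ C * Real.exp (-ε * s)) (hε1 : 1 < ε)

include hlam hg hM hM0 hC hε1 in
/-- **THE SHARP `L²` BOUND OF THE ITERATES ON THE CLASS**: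
`∫_{(0,∞)} sinh 2t ((G^I_λ)ⁿ g)² ≤ (∫_{(0,∞)} sinh 2t g²)/(((λ − 1)²)²)ⁿ` for every `n`, every `λ > 1`, source rate `ε > 1`. -/
theorem integral_sinh_mul_iterate_sq_le (n : ℕ) :
    ∫ t in Ioi 0, Real.sinh (2 * t) * ((greenSolI (fun t => sph lam (hyp t)) (sphDecay lam))^[n] g) t ^ 2
      ≤ (∫ t in Ioi 0, Real.sinh (2 * t) * g t ^ 2) / (((lam - 1) ^ 2) ^ 2) ^ n := by
  have hε : 2 - lam < ε := by linarith
  induction n with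
  | zero => simp
  | succ n ih =>
    -- the `n`-th iterate is in the class at the rate `ε′ ∈ (1, min(ε, λ))`
    have hmin : 1 < min ε lam := lt_min hε1 hlam
    set ε' := (1 + min ε lam) / 2 with hε'
    have hε'1 : 1 < ε' := by rw [hε']; linarith
    have hε'2 : ε' < min ε lam := by rw [hε']; linarith
    have hε'lam : 2 - lam < ε' := by linarith
    obtain ⟨hcont, ⟨M', hM'0, hM'⟩, hdec⟩ := iterate_class hlam hg hM hM0 hε hC n
    obtain ⟨K, T, _, _, hKT⟩ := hdec ε' hε'2
    have hstep := integral_sinh_mul_greenSolI_sq_le_all hlam hcont hM' hM'0 hε'lam hKT hε'1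
    have hp : 0 < ((lam - 1) ^ 2) ^ 2 := by
      have : 0 < lam - 1 := by linarith
      positivity
    have hpn : 0 < (((lam - 1) ^ 2) ^ 2) ^ n := pow_pos hp n
    rw [Function.iterate_succ_apply']
    calc ∫ t in Ioi 0, Real.sinh (2 * t) * greenSolI (fun t => sph lam (hyp t)) (sphDecay lam)
          ((greenSolI (fun t => sph lam (hyp t)) (sphDecay lam))^[n] g) t ^ 2
        ≤ (∫ t in Ioi 0, Real.sinh (2 * t) * ((greenSolI (fun t => sph lam (hyp t)) (sphDecay lam))^[n] g) t ^ 2)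
            / ((lam - 1) ^ 2) ^ 2 := hstep
      _ ≤ ((∫ t in Ioi 0, Real.sinh (2 * t) * g t ^ 2) / (((lam - 1) ^ 2) ^ 2) ^ n) / ((lam - 1) ^ 2) ^ 2 :=
          div_le_div_of_nonneg_right ih hp.le
      _ = (∫ t in Ioi 0, Real.sinh (2 * t) * g t ^ 2) / (((lam - 1) ^ 2) ^ 2) ^ (n + 1) := by
          rw [pow_succ (((lam - 1) ^ 2) ^ 2) n, div_div]

include hlam hg hM hM0 hC hε1 in
/-- **`‖c (G^I_λ)ⁿ g‖² ≤ c² ‖g‖²/((λ − 1)⁴)ⁿ`** for every scalar `c`. -/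
theorem integral_sinh_mul_smul_iterate_sq_le (c : ℝ) (n : ℕ) :
    ∫ t in Ioi 0, Real.sinh (2 * t) * (c * ((greenSolI (fun t => sph lam (hyp t)) (sphDecay lam))^[n] g) t) ^ 2
      ≤ c ^ 2 * ((∫ t in Ioi 0, Real.sinh (2 * t) * g t ^ 2) / (((lam - 1) ^ 2) ^ 2) ^ n) := by
  have e : (fun t => Real.sinh (2 * t) * (c * ((greenSolI (fun t => sph lam (hyp t)) (sphDecay lam))^[n] g) t) ^ 2)
      = fun t => c ^ 2 * (Real.sinh (2 * t) * ((greenSolI (fun t => sph lam (hyp t)) (sphDecay lam))^[n] g) t ^ 2) := by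
    funext t; ring
  rw [e, MeasureTheory.integral_const_mul]
  exact mul_le_mul_of_nonneg_left (integral_sinh_mul_iterate_sq_le hlam hg hM hM0 hC hε1 n) (sq_nonneg _)

include hlam hg hM hM0 hC hε1 in
/-- **The `L²` norm of the `k`-th term of the Neumann series** `Σ (μ′ − μ)ᵏ (G^I_λ)^{k+1} g` (row 506) is at most
`|μ′ − μ|ᵏ ‖g‖/(λ − 1)^{2(k+1)}`: `‖(μ′ − μ)ᵏ (G^I_λ)^{k+1} g‖² ≤ ((μ′ − μ)²)ᵏ ‖g‖²/((λ − 1)⁴)^{k+1}` — geometric with ratio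
`|μ′ − μ|/(λ − 1)²`. -/
theorem neumann_term_l2_le (μ' : ℝ) (k : ℕ) :
    ∫ t in Ioi 0, Real.sinh (2 * t)
        * ((μ' - lam * (lam - 2)) ^ k * ((greenSolI (fun t => sph lam (hyp t)) (sphDecay lam))^[k + 1] g) t) ^ 2
      ≤ ((μ' - lam * (lam - 2)) ^ 2) ^ k
          * ((∫ t in Ioi 0, Real.sinh (2 * t) * g t ^ 2) / (((lam - 1) ^ 2) ^ 2) ^ (k + 1)) := by
  have h := integral_sinh_mul_smul_iterate_sq_le hlam hg hM hM0 hC hε1 ((μ' - lam * (lam - 2)) ^ k) (k + 1)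
  rwa [← pow_mul, mul_comm k 2, pow_mul] at h

end measure

end Summit.Ventures.HodgeRepro2.T5SU11ImproperL2Iterates
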